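import Summits.ValiantsHypothesis.ValiantsHypothesis.Theorems.SymPencilPerFourRowForms

/-!
# Route `SymPencil` — `per [w; ·]` has no linear factor (tool for the one-row kernel cells of
# `sdc(per_4)`, `--supports` stmt-ValiantsHypothesis-5674; nothing here bears on `VP ≠ VNP`)

Fix `w ∈ K⁴`, `w ≠ 0`, and the cubic form on `3 × 4` matrices `x = (x 0, x 1, x 2)` (rows)

  `F_w(x) = per [w; x 0; x 1; x 2]`        (the `4 × 4` permanent with first row `w`).

**Theorem** (`permanent_rows_ne_linear_mul_quadratic`).  There are no linear form `c` and bilinear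
form `B` with `F_w(x) = c(x) · B(x, x)` for all `x` (characteristic `0`).

Proof (evaluations only).  Rescaling the row `x 0` by `t` separates `t F_w = c(x_t) B(x_t, x_t)`
by degree in `t` (`cubic_coeffs_eq_zero`).  If `c` sees the row `0` (`c(e₀ ⊗ y₀) ≠ 0` for some
`y₀`), the `t³`-coefficient `c(e₀⊗y) B(e₀⊗y, e₀⊗y) = 0` kills the `(0,0)` block of `B`
(`quad_eq_zero_of_linear_mul`), then the `t²`-coefficient kills the mixed blocks
(`bilin_eq_zero_of_linear_mul`), and the `t¹`-coefficient leaves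
`F_w(x) = ℓ(x 0) · β(x 1, x 2)`; but `per [w; e_k; e_j; e_l] = w_m ≠ 0` and
`per [w; e_k; e_k; e_l] = 0` are incompatible with such a factorisation (`false_of_factor_test`).
The rows `1, 2` reduce to row `0` by the symmetry of `F_w` in its three rows, and if `c` sees no
row then `c = 0` and `F_w ≡ 0`, absurd.  Used by the hyperplane version of the one-row kernel
kill (`SymPencilPerFourOneRowPoint`), cell `(13, 3, 0)` of the size-`27` table. [folklore]
-/

noncomputable section

-- single-conjunct layout: Sub = Summit, duplicated namespace component intended
set_option linter.dupNamespace false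

namespace Summit.ValiantsHypothesis.ValiantsHypothesis.Theorems.SymPencilPerFourRowNoLinearFactor

open Matrix
open Summit.ValiantsHypothesis.ValiantsHypothesis.Theorems.SymPencilPerFourInnerRankRows
open Summit.ValiantsHypothesis.ValiantsHypothesis.Theorems.SymPencilPerFourRowForms

variable {K : Type*} [Field K]

/-! ### Three small algebraic lemmas -/

/-- A cubic `a₀ + a₁ t + a₂ t² + a₃ t³` vanishing at `t = 0, 1, -1, 2` vanishes identically
(characteristic `0`). [folklore] -/
theorem cubic_coeffs_eq_zero [CharZero K] (a₀ a₁ a₂ a₃ : K)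
    (h : ∀ t : K, a₀ + a₁ * t + a₂ * t ^ 2 + a₃ * t ^ 3 = 0) :
    a₀ = 0 ∧ a₁ = 0 ∧ a₂ = 0 ∧ a₃ = 0 := by
  have h0 := h 0
  have h1 := h 1
  have h2 := h (-1)
  have h3 := h 2
  have e0 : a₀ = 0 := by linear_combination h0
  have e2 : (2 : K) * a₂ = 0 := by linear_combination h1 + h2 - 2 * h0
  have ha2 : a₂ = 0 := (mul_eq_zero.1 e2).resolve_left two_ne_zero
  have e3 : (6 : K) * a₃ = 0 := by linear_combination h3 - 2 * h1 + h0 - 2 * ha2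
  have ha3 : a₃ = 0 := (mul_eq_zero.1 e3).resolve_left (by norm_num)
  exact ⟨e0, by linear_combination h1 - h0 - ha2 - ha3, ha2, ha3⟩

/-- If `c(y) · B(y, y) = 0` identically and the linear form `c` is non-zero, then the quadratic
form `B(y, y)` vanishes identically. [folklore] -/
theorem quad_eq_zero_of_linear_mul [CharZero K] {M : Type*} [AddCommGroup M] [Module K M]
    (c : M →ₗ[K] K) (B : M →ₗ[K] M →ₗ[K] K) (h : ∀ y, c y * B y y = 0) {y₀ : M}
    (hy₀ : c y₀ ≠ 0) (y : M) : B y y = 0 := by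
  have hcubic : ∀ t : K,
      c y * B y y + (c y * (B y y₀ + B y₀ y) + c y₀ * B y y) * t +
        (c y * B y₀ y₀ + c y₀ * (B y y₀ + B y₀ y)) * t ^ 2 + (c y₀ * B y₀ y₀) * t ^ 3 = 0 := by
    intro t
    have h1 := h (y + t • y₀)
    simp only [map_add, map_smul, LinearMap.add_apply, LinearMap.smul_apply, smul_eq_mul] at h1
    linear_combination h1
  obtain ⟨-, e1, e2, e3⟩ := cubic_coeffs_eq_zero _ _ _ _ hcubic
  have h00 : B y₀ y₀ = 0 := (mul_eq_zero.1 e3).resolve_left hy₀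
  rw [h00, mul_zero, zero_add] at e2
  have h01 : B y y₀ + B y₀ y = 0 := (mul_eq_zero.1 e2).resolve_left hy₀
  rw [h01, mul_zero, zero_add] at e1
  exact (mul_eq_zero.1 e1).resolve_left hy₀

/-- If `c(y) · Q(y, z) = 0` identically and the linear form `c` is non-zero, then the bilinear
map `Q` vanishes identically. [folklore] -/
theorem bilin_eq_zero_of_linear_mul {M N : Type*} [AddCommGroup M] [Module K M] [AddCommGroup N]
    [Module K N] (c : M →ₗ[K] K) (Q : M →ₗ[K] N →ₗ[K] K) {y₀ : M} (hy₀ : c y₀ ≠ 0)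
    (h : ∀ y z, c y * Q y z = 0) (y : M) (z : N) : Q y z = 0 := by
  by_cases hy : c y = 0
  · have h1 := h (y + y₀) z
    have h2 : Q y₀ z = 0 := (mul_eq_zero.1 (h y₀ z)).resolve_left hy₀
    rw [map_add, hy, zero_add, map_add, LinearMap.add_apply, h2, add_zero] at h1
    exact (mul_eq_zero.1 h1).resolve_left hy₀
  · exact (mul_eq_zero.1 (h y z)).resolve_left hy

/-! ### The test-matrix obstruction -/

/-- Three indices completing `m` to an enumeration of `Fin 4`. [folklore] -/
theorem exists_three_compl : ∀ m : Fin 4, ∃ j k l : Fin 4,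
    j ≠ k ∧ j ≠ l ∧ j ≠ m ∧ k ≠ l ∧ k ≠ m ∧ l ≠ m := by
  decide

/-- **No factorisation `F_w(x) = ℓ(x 0) · β(x 1, x 2)`** when `w ≠ 0`: the test values
`per [w; e_k; e_j; e_l] = w_m` and `per [w; e_k; e_k; e_l] = 0` are incompatible with it.
[folklore] -/
theorem false_of_factor_test {w : Fin 4 → K} (ℓ : (Fin 4 → K) → K)
    (β : (Fin 4 → K) → (Fin 4 → K) → K)
    (hF : ∀ x : Fin 3 → Fin 4 → K,
      (Matrix.of ![w, x 0, x 1, x 2]).permanent = ℓ (x 0) * β (x 1) (x 2))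
    (j k l m : Fin 4) (hd : j ≠ k ∧ j ≠ l ∧ j ≠ m ∧ k ≠ l ∧ k ≠ m ∧ l ≠ m) (hm : w m ≠ 0) :
    False := by
  obtain ⟨hjk, hjl, hjm, hkl, hkm, hlm⟩ := hd
  have h1 := hF ![Pi.single k 1, Pi.single j 1, Pi.single l 1]
  have h2 := hF ![Pi.single k 1, Pi.single k 1, Pi.single l 1]
  have h3 := hF ![Pi.single j 1, Pi.single k 1, Pi.single l 1]
  simp only [Matrix.cons_val_zero, Matrix.cons_val_one, Matrix.cons_val_two, Matrix.head_cons,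
    Matrix.tail_cons] at h1 h2 h3
  rw [permanent_rows_three_single w k j l m ⟨hjk.symm, hkl, hkm, hjl, hjm, hlm⟩] at h1
  rw [permanent_rows_rep] at h2
  rw [permanent_rows_three_single w j k l m ⟨hjk, hjl, hjm, hkl, hkm, hlm⟩] at h3
  have hℓk : ℓ (Pi.single k 1) ≠ 0 := fun h => hm (by rw [h1, h, zero_mul])
  have hβ : β (Pi.single k 1) (Pi.single l 1) = 0 := (mul_eq_zero.1 h2.symm).resolve_left hℓk
  exact hm (by rw [h3, hβ, mul_zero])

/-! ### The case where `c` sees the row `0` -/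

/-- Homogeneity of `per [w; a; b; c]` in the row `a` (restated for rows of a `3 × 4` matrix).
[folklore] -/
theorem permanent_rows_smul_row0 (w : Fin 4 → K) (x : Fin 3 → Fin 4 → K) (t : K) :
    (Matrix.of ![w, t • x 0, x 1, x 2]).permanent =
      t * (Matrix.of ![w, x 0, x 1, x 2]).permanent :=
  permanent_rows_smul₁ w (x 0) (x 1) (x 2) t

/-- **Key case.**  If `F_w(x) = c(x) B(x, x)` for all `x`, `w ≠ 0`, and `c (e₀ ⊗ y₀) ≠ 0` for some
`y₀`, contradiction.  See the module docstring. [folklore] -/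
theorem false_of_linear_mul_quadratic_row0 [CharZero K] {w : Fin 4 → K} (hw : w ≠ 0)
    (c : (Fin 3 → Fin 4 → K) →ₗ[K] K)
    (B : (Fin 3 → Fin 4 → K) →ₗ[K] (Fin 3 → Fin 4 → K) →ₗ[K] K)
    (h : ∀ x, (Matrix.of ![w, x 0, x 1, x 2]).permanent = c x * B x x)
    (h0 : ∃ y₀ : Fin 4 → K, c (Pi.single 0 y₀) ≠ 0) : False := by
  classical
  -- the row-`0` embedding `sng` and the projection `π` onto the rows `1, 2`
  let sng : (Fin 4 → K) →ₗ[K] (Fin 3 → Fin 4 → K) :=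
    LinearMap.single K (fun _ : Fin 3 => Fin 4 → K) 0
  have hsng : ∀ y, sng y = Pi.single 0 y := fun y => rfl
  let π : (Fin 3 → Fin 4 → K) →ₗ[K] (Fin 3 → Fin 4 → K) :=
    LinearMap.id - sng ∘ₗ LinearMap.proj 0
  have hπ : ∀ x, π x = x - Pi.single 0 (x 0) := fun x => rfl
  have hπv : ∀ x, π x = ![(0 : Fin 4 → K), x 1, x 2] := by
    intro x
    rw [hπ]
    funext a
    fin_cases a <;> simp
  have hπ0 : ∀ x, π x 0 = 0 := fun x => by rw [hπv]; rfl
  have hπ1 : ∀ x, π x 1 = x 1 := fun x => by rw [hπv]; rfl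
  have hπ2 : ∀ x, π x 2 = x 2 := fun x => by rw [hπv]; rfl
  have hsng0 : ∀ y : Fin 4 → K, (Pi.single (0 : Fin 3) y : Fin 3 → Fin 4 → K) 0 = y :=
    fun y => by simp
  have hsng1 : ∀ y : Fin 4 → K, (Pi.single (0 : Fin 3) y : Fin 3 → Fin 4 → K) 1 = 0 :=
    fun y => by simp
  have hsng2 : ∀ y : Fin 4 → K, (Pi.single (0 : Fin 3) y : Fin 3 → Fin 4 → K) 2 = 0 :=
    fun y => by simp
  have hπsng : ∀ y, π (sng y) = 0 := fun y => by
    rw [hπv, hsng, hsng1, hsng2]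
    funext a; fin_cases a <;> rfl
  have hππ : ∀ x, π (π x) = π x := fun x => by
    conv_lhs => rw [hπv x]
    rw [hπv, hπv]
    rfl
  -- the coefficient identities from rescaling the row `0`
  have hcoef : ∀ x : Fin 3 → Fin 4 → K,
      c (π x) * B (π x) (π x) = 0 ∧
      c (π x) * (B (sng (x 0)) (π x) + B (π x) (sng (x 0))) + c (sng (x 0)) * B (π x) (π x) -
          (Matrix.of ![w, x 0, x 1, x 2]).permanent = 0 ∧
      c (π x) * B (sng (x 0)) (sng (x 0)) +
          c (sng (x 0)) * (B (sng (x 0)) (π x) + B (π x) (sng (x 0))) = 0 ∧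
      c (sng (x 0)) * B (sng (x 0)) (sng (x 0)) = 0 := by
    intro x
    refine cubic_coeffs_eq_zero _ _ _ _ fun t => ?_
    have hx : ∀ s : K, (π x + s • sng (x 0)) 0 = s • x 0 ∧ (π x + s • sng (x 0)) 1 = x 1 ∧
        (π x + s • sng (x 0)) 2 = x 2 := fun s => by
      refine ⟨?_, ?_, ?_⟩ <;>
        simp only [Pi.add_apply, Pi.smul_apply, hπ0, hπ1, hπ2, hsng, hsng0, hsng1, hsng2,
          smul_zero, add_zero, zero_add]
    have h1 := h (π x + t • sng (x 0))
    obtain ⟨e0, e1, e2⟩ := hx t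
    rw [e0, e1, e2, permanent_rows_smul_row0] at h1
    simp only [map_add, map_smul, LinearMap.add_apply, LinearMap.smul_apply, smul_eq_mul] at h1
    linear_combination -h1
  -- (1) the `(0,0)` block of `B` is zero
  obtain ⟨y₀, hy₀⟩ := h0
  have hB00 : ∀ y : Fin 4 → K, B (sng y) (sng y) = 0 := by
    refine quad_eq_zero_of_linear_mul (c ∘ₗ sng) (B.compl₁₂ sng sng) (fun y => ?_)
      (y₀ := y₀) (by rw [LinearMap.comp_apply, hsng]; exact hy₀)
    have e : sng y 0 = y := by rw [hsng]; exact hsng0 y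
    have h3 := (hcoef (sng y)).2.2.2
    rw [e] at h3
    simpa only [LinearMap.comp_apply, LinearMap.compl₁₂_apply] using h3
  -- (2) the mixed blocks are zero
  have hQ : ∀ (y : Fin 4 → K) (z : Fin 3 → Fin 4 → K),
      B (sng y) (π z) + B (π z) (sng y) = 0 := by
    intro y z
    have key := bilin_eq_zero_of_linear_mul (c ∘ₗ sng)
      (B.compl₁₂ sng π + B.flip.compl₁₂ sng π) (y₀ := y₀)
      (by rw [LinearMap.comp_apply, hsng]; exact hy₀) (fun y' z' => ?_) y z
    · simpa only [LinearMap.add_apply, LinearMap.compl₁₂_apply, LinearMap.flip_apply] using key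
    have h2 := (hcoef (π z' + sng y')).2.2.1
    have e0 : (π z' + sng y') 0 = y' := by
      rw [Pi.add_apply, hπ0, hsng, hsng0, zero_add]
    rw [e0, map_add, hππ, hπsng, add_zero, hB00, mul_zero, zero_add] at h2
    simpa only [LinearMap.comp_apply, LinearMap.add_apply, LinearMap.compl₁₂_apply,
      LinearMap.flip_apply] using h2
  -- (3) the factorisation `F_w(x) = c(e₀ ⊗ x 0) · B(π x, π x)`
  have hfac : ∀ x : Fin 3 → Fin 4 → K,
      (Matrix.of ![w, x 0, x 1, x 2]).permanent =
        c (Pi.single 0 (x 0)) * B ![0, x 1, x 2] ![0, x 1, x 2] := by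
    intro x
    have h1 := (hcoef x).2.1
    rw [hQ, mul_zero, zero_add, hπv] at h1
    rw [← hsng]
    linear_combination -h1
  -- (4) the test-matrix obstruction
  obtain ⟨m, hm⟩ := Function.ne_iff.1 hw
  obtain ⟨j, k, l, hd⟩ := exists_three_compl m
  exact false_of_factor_test (fun y => c (Pi.single 0 y)) (fun b d => B ![0, b, d] ![0, b, d])
    hfac j k l m hd hm

/-! ### The theorem -/

/-- Row swap `0 ↔ 1` of a `3 × 4` matrix does not change `F_w`. [folklore] -/
theorem permanent_rows_swap_row01 (w : Fin 4 → K) (x : Fin 3 → Fin 4 → K) :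
    (Matrix.of ![w, x 1, x 0, x 2]).permanent = (Matrix.of ![w, x 0, x 1, x 2]).permanent :=
  (permanent_rows_swap₁₂ w (x 0) (x 1) (x 2)).symm

/-- Row swap `0 ↔ 2` of a `3 × 4` matrix does not change `F_w`. [folklore] -/
theorem permanent_rows_swap_row02 (w : Fin 4 → K) (x : Fin 3 → Fin 4 → K) :
    (Matrix.of ![w, x 2, x 1, x 0]).permanent = (Matrix.of ![w, x 0, x 1, x 2]).permanent := by
  simp only [permanent_of_rows]; ring

/-- **`per [w; ·]` is not the product of a linear and a quadratic form** (`w ≠ 0`,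
characteristic `0`).  See the module docstring. [folklore] -/
theorem permanent_rows_ne_linear_mul_quadratic [CharZero K] {w : Fin 4 → K} (hw : w ≠ 0)
    (c : (Fin 3 → Fin 4 → K) →ₗ[K] K)
    (B : (Fin 3 → Fin 4 → K) →ₗ[K] (Fin 3 → Fin 4 → K) →ₗ[K] K) :
    ¬ ∀ x, (Matrix.of ![w, x 0, x 1, x 2]).permanent = c x * B x x := by
  classical
  intro h
  by_cases h0 : ∃ y₀ : Fin 4 → K, c (Pi.single 0 y₀) ≠ 0
  · exact false_of_linear_mul_quadratic_row0 hw c B h h0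
  -- transport a row `a ∈ {1, 2}` to the row `0`
  have transport : ∀ σ : Equiv.Perm (Fin 3),
      (∀ x : Fin 3 → Fin 4 → K, (Matrix.of ![w, x (σ 0), x (σ 1), x (σ 2)]).permanent =
        (Matrix.of ![w, x 0, x 1, x 2]).permanent) →
      (∃ y₀ : Fin 4 → K, c (Pi.single (σ.symm 0) y₀) ≠ 0) → False := by
    intro σ hσ hy
    let T : (Fin 3 → Fin 4 → K) →ₗ[K] (Fin 3 → Fin 4 → K) := LinearMap.funLeft K (Fin 4 → K) σ
    have hT : ∀ x a, T x a = x (σ a) := fun x a => rfl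
    refine false_of_linear_mul_quadratic_row0 hw (c ∘ₗ T) (B.compl₁₂ T T) (fun x => ?_) ?_
    · rw [LinearMap.comp_apply, LinearMap.compl₁₂_apply, ← h (T x), hT, hT, hT, hσ]
    · obtain ⟨y₀, hy₀⟩ := hy
      refine ⟨y₀, ?_⟩
      have hTs : T (Pi.single 0 y₀) = Pi.single (σ.symm 0) y₀ := by
        funext a
        rw [hT]
        by_cases ha : a = σ.symm 0
        · subst ha
          rw [Equiv.apply_symm_apply, Pi.single_eq_same, Pi.single_eq_same]
        · have hσa : σ a ≠ 0 := fun h' => ha (by rw [← h', Equiv.symm_apply_apply])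
          rw [Pi.single_eq_of_ne hσa, Pi.single_eq_of_ne ha]
      rwa [LinearMap.comp_apply, hTs]
  by_cases h1 : ∃ y₀ : Fin 4 → K, c (Pi.single 1 y₀) ≠ 0
  · refine transport (Equiv.swap 0 1) (fun x => ?_) ?_
    · rw [Equiv.swap_apply_left, Equiv.swap_apply_right,
        Equiv.swap_apply_of_ne_of_ne (by decide) (by decide)]
      exact permanent_rows_swap_row01 w x
    · rw [Equiv.symm_swap, Equiv.swap_apply_left]; exact h1
  by_cases h2 : ∃ y₀ : Fin 4 → K, c (Pi.single 2 y₀) ≠ 0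
  · refine transport (Equiv.swap 0 2) (fun x => ?_) ?_
    · rw [Equiv.swap_apply_left, Equiv.swap_apply_right,
        Equiv.swap_apply_of_ne_of_ne (by decide) (by decide)]
      exact permanent_rows_swap_row02 w x
    · rw [Equiv.symm_swap, Equiv.swap_apply_left]; exact h2
  -- `c` sees no row: `c = 0`, so `F_w ≡ 0`, absurd
  push Not at h0 h1 h2
  have hc : ∀ x, c x = 0 := by
    intro x
    have hx : x = Pi.single 0 (x 0) + Pi.single 1 (x 1) + Pi.single 2 (x 2) := by
      funext a; fin_cases a <;> simp
    rw [hx, map_add, map_add, h0, h1, h2, add_zero, add_zero]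
  obtain ⟨m, hm⟩ := Function.ne_iff.1 hw
  obtain ⟨j, k, l, hd⟩ := exists_three_compl m
  have h3 := h ![Pi.single j 1, Pi.single k 1, Pi.single l 1]
  simp only [Matrix.cons_val_zero, Matrix.cons_val_one, Matrix.cons_val_two, Matrix.head_cons,
    Matrix.tail_cons] at h3
  rw [permanent_rows_three_single w j k l m ⟨hd.1, hd.2.1, hd.2.2.1, hd.2.2.2.1, hd.2.2.2.2.1,
    hd.2.2.2.2.2⟩, hc, zero_mul] at h3
  exact hm h3

end Summit.ValiantsHypothesis.ValiantsHypothesis.Theorems.SymPencilPerFourRowNoLinearFactor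

end
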